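import Literature.NumberTheory.Automorphic.CMPrincipalSeriesTraceOrbitalForm        -- ★ (N-492S) S4∕G-side: `smoothTrace_cmPrincipalSeries_map_symm_eq_inv_mul_integral` (van Dijk vs CANONICAL orbital integrals)
import Literature.NumberTheory.Automorphic.CMTorusRegularAEPairwise               -- ★ `ae_isUnit_torusEntry_sub_three` (a.e. regularity on the split torus)
import Literature.NumberTheory.Automorphic.UnitaryGroupFormCongrFinSum            -- ★ `formCongr_one_eq` (the identity frame)
import Literature.NumberTheory.Automorphic.CMPrincipalSeriesJacquetEvalOne          -- ★ `continuous_cmTorusCharPair_apply`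
import Literature.NumberTheory.Automorphic.UnitaryGroupPrincipalSeriesExponents     -- ★ `cmTorusCharPair`, `conjInvChar` (the PAIR currency)
import Literature.NumberTheory.Automorphic.LocalUnitaryGroupCongr                   -- ★ `cmDatumLocalCongr`, `antidiagOne_isHermitian`, `isUnit_antidiagOne_det`
import Literature.NumberTheory.Rogawski1990.UnitOrbitalIntegralValueOfCongr         -- ★ `isRegularElt_of_eigenframe`
import Literature.NumberTheory.Rogawski1990.CMCharIdentityClauses                   -- ★ organ vocabulary (`Gqs`, `qsForm`)
import Literature.NumberTheory.Rogawski1990.Ch12Sec5Defs                            -- ★ TR carpet: `EllipticData`, `IsPseudoCoeff`, `orbInt`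
import Literature.NumberTheory.Automorphic.OrbitalMeasureCanonical                  -- ★ `OrbitalMeasureFamily.IsCanonical`
import HarnessLib

/-!
# F0 · P3c · line LH6 «StCharTS» — «PSE★»: PRINCIPAL-SERIES CHARACTERS VANISH AGAINST PSEUDO-COEFFICIENTS, ON THE MODEL `U(Φ₃)(L⁺_v)`
# [Rogawski1990, §12.6 p. 187 «`Φ(γ, f_π) = 0` if `γ ∈ G^r − G^e`»; §4.9 (4.9.4) p. 56; §12.7 L. 12.7.2 (proof) p. 192]

Cell `pub/hodgecm-mathlib`, crux H413 = `stmt-HodgeConjecture-24833` (`--supports` lane, helper), route HCCMUnconditional; seat LH6-p01 (g2); DEFAULT organ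
05:0xZ (while «TOR-DATA★» HAND 2 runs at LH6-p05 (g2)).  THEOREMS ONLY, sorry-free, no definition ∕ instance ∕ notation ∕ named fact; the §12.5 datum `𝔇` is a
BINDER.  DISCHARGES the socket **(PSE)** of the (S-a) head (★ `F0P3cStCharTSSaHead.stSupportFiniteSqInt_of_carpet`, p849227, binder :335–336; and of the
concrete-torus edition `F0P3cStCharTSSaHeadTorus`): its conclusion is the (PSE) text VERBATIM —
«for every class `π` with `𝔇.IsL2 π`, every `𝔇`-pseudo-coefficient `f` of `π` and every CONTINUOUS pair `χ = (χ₁, χ₂)`,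
`Tr i_G(χ)(f) = Representation.smoothTrace (cmPrincipalSeries L 3 v (cmTorusCharPair L v χ₁ χ₂)) νQv f = 0`» — from two COMPAT clauses of the (S-𝔇) package
(`𝔇.orb = mQv`, `γ ∈ 𝔇.regG ↔ IsRegularElt γ`) and ONE structural socket **(SPLIT-NOT-ELL)** «a REGULAR element of the split torus `T = (cmBorelTriple L 3 v).M`
is not in `𝔇.ellG`» (print: `G^e` = the regular elements whose centraliser is compact modulo the centre, §12.5 p. 184; the split torus is not — same nature as the
sockets (C2)(C3) ★ `EllCartanAE` ∕ `NonEllCartanAE`).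
THE PROOF (print p. 187 + (4.9.4)): a pseudo-coefficient has `Φ(γ, f) = 0` on `G^r ∖ G^e` (★ `IsPseudoCoeff`, second clause; `𝔇.orbInt γ f =
classOrbitalIntegral 𝔇.orb f ⟦γ⟧`); van Dijk's formula AGAINST CANONICAL ORBITAL INTEGRALS (★ `smoothTrace_cmPrincipalSeries_map_symm_eq_inv_mul_integral`, the
(N-492S) road's S0∕S1∕S4, here at the IDENTITY frame `e = cmDatumLocalCongr L v 1 …` of `U(Φ₃)(L⁺_v)`, ★ `formCongr_one_eq`) reads `Tr i_G(χ)(f) = μ_T(T ∩ K_v)⁻¹ ·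
∫_T Φ dμ_T` for ANY `Φ` that agrees `μ_T`-a.e. with `χ δ_B^{1∕2} J₃⁻¹ · O^{can}_t(f)`; `μ_T`-a.e. `t ∈ T` is regular (★ `ae_isUnit_torusEntry_sub_three` + ★
`isRegularElt_of_eigenframe`), hence in `regG ∖ ellG` by COMPAT + (SPLIT-NOT-ELL), so `O^{can}_t(f) = 0` and `Φ := 0` qualifies: `Tr i_G(χ)(f) = 0`.
HONEST LABEL: HC_CM is proved only modulo the 7 printed citations (2 remaining: hLiu418 = stmt-HodgeConjecture-24832, h413 = stmt-HodgeConjecture-24833) until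
rung 0 closes; count-neutral, hypothesis-fed (the datum and its three clauses are binders).

ED. 2 (LH6-p02 (g4), 2026-09-02): `psTrace_pseudoCoeff_eq_zero_of_isPseudoCoeff` — the same conclusion WITHOUT the (unused) hypothesis `𝔇.IsL2 π`, for the
pseudo-coefficient of ANY class (ED. 1's proof never used square-integrability: only `Φ(γ, f) = 0` off `G^e`); ED. 1's head is re-proved as its one-line corollary,
statement byte-identical.  Consumer: ★ «MATE-UNIQ-OUT★» (the pseudo-coefficient of a non-square-integrable elliptic partner kills `χ_u + χ_σ = χ_{i_G(χ)}`, p. 192).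

## References
* [Rogawski1990] J. D. Rogawski, *Automorphic Representations of Unitary Groups in Three Variables*, Ann. of Math. Stud. 123 (1990): §12.6 p. 187 (pseudo-coefficients:
  `Φ(γ, f_π) = 0` off `G^e`); §4.9 Lemma 4.9.2, (4.9.4) p. 56 (characters of `i_G(χ)` as torus integrals of orbital integrals); §12.5 p. 184 (`G^e`); §12.7 L. 12.7.2
  (proof) p. 192 («`Tr(i_G(θ̃)(f)) = 0`» for a pseudo-coefficient `f`).
* [vanDijk1972] G. van Dijk, *Computation of certain induced characters of 𝔭-adic groups*, Math. Ann. 199 (1972), Thm. p. 237.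
-/

set_option autoImplicit false
-- the mandated namespace has the single-problem summit's repeated segment (`HodgeConjecture.HodgeConjecture`)
set_option linter.dupNamespace false

noncomputable section

open NumberField IsDedekindDomain MeasureTheory MeasureTheory.Measure Filter Topology
open scoped Matrix MatrixGroups
open Literature.NumberTheory.Rogawski1990 Literature.NumberTheory.Automorphic Literature.NumberTheory.Automorphic.UnitaryGroup

namespace Summit.HodgeConjecture.HodgeConjecture.Cruxes.H413.F0P3cStCharTSPsePseudo

open Literature.NumberTheory.Rogawski1990.Ch12Sec5

set_option maxHeartbeats 1600000 in
set_option synthInstance.maxHeartbeats 400000 in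
/-- **«PSE★» WITHOUT THE SQUARE-INTEGRABILITY HYPOTHESIS (ED. 2)** — `Tr i_G(χ)(f) = 0` for a `𝔇`-pseudo-coefficient `f` of ANY class `π` (elliptic or not: only the
clause «`Φ(γ, f) = 0` on `G^r ∖ G^e`» of ★ `IsPseudoCoeff` is used) and every continuous pair `χ`, on `U(Φ₃)(L⁺_v)` (`v` non-split), from COMPAT (`𝔇.orb = mQv`,
`regG ↔ IsRegularElt`) and (SPLIT-NOT-ELL).  ED. 1's head `psTrace_pseudoCoeff_eq_zero` below is its corollary (statement unchanged); the hypothesis-free form is what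
the (MATE-UNIQ) derivation needs (the pseudo-coefficient there is that of a NON-square-integrable elliptic partner).  Proof = ED. 1's, verbatim.
[cite: Rogawski1990, §12.6 p. 187; §4.9 (4.9.4) p. 56; §12.7 Lemma 12.7.2 (proof) p. 192] -/
theorem psTrace_pseudoCoeff_eq_zero_of_isPseudoCoeff
    (L : Type) [Field L] [NumberField L] [IsCMField L] (v : HeightOneSpectrum (𝓞 ↥(maximalRealSubfield L)))
    (hns : ∀ w : PlacesOver L v, IsCMField.complexConj L • w.1 = w.1)
    [MeasurableSpace ((UnitaryGroup.cmDatum L 2 (Matrix.of fun i j : Fin 2 => if i.val + j.val + 1 = 2 then (1 : L) else 0)).Local v × (UnitaryGroup.cmDatum L 1 (Matrix.of fun i j : Fin 1 => if i.val + j.val + 1 = 1 then (1 : L) else 0)).Local v)]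
    [MeasurableSpace (Gqs L v)] [BorelSpace (Gqs L v)]
    [∀ γ : Gqs L v, MeasurableSpace (Gqs L v ⧸ Subgroup.centralizer ({γ} : Set (Gqs L v)))]
    [∀ γ : Gqs L v, BorelSpace (Gqs L v ⧸ Subgroup.centralizer ({γ} : Set (Gqs L v)))]
    [MeasurableSpace (Gqs L v ⧸ Subgroup.center (Gqs L v))]
    (νQv : Measure (Gqs L v)) [νQv.IsHaarMeasure] [νQv.IsMulRightInvariant]
    (mQv : OrbitalMeasureFamily (Gqs L v))
    (hcanQ : mQv.IsCanonical (fun γ => IsRegularElt (γ.val : GL (Fin 3) (UnitaryGroup.LocalRing L v))) νQv)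
    (𝔇 : Ch12Sec5.EllipticData (Gqs L v) ((UnitaryGroup.cmDatum L 2 (Matrix.of fun i j : Fin 2 => if i.val + j.val + 1 = 2 then (1 : L) else 0)).Local v × (UnitaryGroup.cmDatum L 1 (Matrix.of fun i j : Fin 1 => if i.val + j.val + 1 = 1 then (1 : L) else 0)).Local v))
    -- ══ COMPAT (two of the seven clauses of the (S-𝔇) package): the datum's orbital-integral family and regular set ARE the organ's ══
    (horb : 𝔇.orb = mQv)
    (hreg : ∀ γ : Gqs L v, γ ∈ 𝔇.regG ↔ IsRegularElt (γ.val : GL (Fin 3) (UnitaryGroup.LocalRing L v)))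
    -- ══ (SPLIT-NOT-ELL) «regular elements of the split torus are not elliptic» [§12.5 p. 184] ══
    (hsplit : ∀ t : ↥(cmBorelTriple L 3 v).M,
      IsRegularElt ((((t : ↥(unitaryGroupOfForm (conjLocal L (IsCMField.complexConj L) v) (cmLocalForm L 3 v))) : Gqs L v).val :
        GL (Fin 3) (UnitaryGroup.LocalRing L v))) →
      ((t : ↥(unitaryGroupOfForm (conjLocal L (IsCMField.complexConj L) v) (cmLocalForm L 3 v))) : Gqs L v) ∉ 𝔇.ellG) :
    ∀ (π : IrrClass (Gqs L v)) (f : Gqs L v → ℂ), 𝔇.IsPseudoCoeff π f →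
      ∀ χ : (((UnitaryGroup.LocalRing L v)ˣ →* ℂˣ) × (↥(normOneUnits (conjLocal L (IsCMField.complexConj L) v)) →* ℂˣ)), Continuous χ.1 → Continuous χ.2 →
        Representation.smoothTrace (G := Gqs L v) (UnitaryGroup.cmPrincipalSeries L 3 v (UnitaryGroup.cmTorusCharPair L v χ.1 χ.2)) νQv f = 0 := by
  intro π f hf χ hχ1 hχ2
  obtain ⟨w⟩ := (inferInstance : Nonempty (PlacesOver L v))
  have hw : IsCMField.complexConj L • w.1 = w.1 := hns w
  -- the organ's measurable structure on `Gqs L v`, re-read on the (definitionally equal) matrix carrier `U(Φ₃)(L⁺_v)` and its split torus `T`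
  letI hmsU : MeasurableSpace ↥(unitaryGroupOfForm (conjLocal L (IsCMField.complexConj L) v) (cmLocalForm L 3 v)) := ‹MeasurableSpace (Gqs L v)›
  haveI : BorelSpace ↥(unitaryGroupOfForm (conjLocal L (IsCMField.complexConj L) v) (cmLocalForm L 3 v)) := ⟨BorelSpace.measurable_eq (α := Gqs L v)⟩
  haveI := locallyCompactSpace_cmBorelU L 3 v
  -- instances on `G₃ = U(Φ₃)(L⁺_v)` and on its split torus `T`
  haveI : LocallyCompactSpace ↥(unitaryGroupOfForm (conjLocal L (IsCMField.complexConj L) v) (cmLocalForm L 3 v)) :=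
    locallyCompactSpace_local (IsCMField.complexConj L) 3 _ v
  haveI : SecondCountableTopology ↥(unitaryGroupOfForm (conjLocal L (IsCMField.complexConj L) v) (cmLocalForm L 3 v)) :=
    secondCountableTopology_local (IsCMField.complexConj L) 3 _ v
  haveI : T2Space ↥(unitaryGroupOfForm (conjLocal L (IsCMField.complexConj L) v) (cmLocalForm L 3 v)) :=
    t2Space_cmDatum_local 3 L (Matrix.of fun i j : Fin 3 => if i.val + j.val + 1 = 3 then (1 : L) else 0) v
  haveI : T1Space (UnitaryGroup.LocalRing L v) := inferInstance
  have hTcl : IsClosed ((cmBorelTriple L 3 v).M : Set ↥(unitaryGroupOfForm (conjLocal L (IsCMField.complexConj L) v) (cmLocalForm L 3 v))) :=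
    isClosed_torusU_of_t1Space (conjLocal L (IsCMField.complexConj L) v) (cmLocalForm L 3 v)
  haveI : SecondCountableTopology ↥(cmBorelTriple L 3 v).M := TopologicalSpace.Subtype.secondCountableTopology _
  haveI : LocallyCompactSpace ↥(cmBorelTriple L 3 v).M := hTcl.isClosedEmbedding_subtypeVal.locallyCompactSpace
  let μT : Measure ↥(cmBorelTriple L 3 v).M := Measure.haar
  -- the identity frame `e = 1` of `U(Φ₃)(L⁺_v)`
  have h1 : formCongr (conjLocal L (IsCMField.complexConj L) v) (1 : GL (Fin 3) (UnitaryGroup.LocalRing L v)) ((qsForm L).map (algebraMap L (UnitaryGroup.LocalRing L v))) =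
      (1 : UnitaryGroup.LocalRing L v) • (Matrix.of fun i j : Fin 3 => if i.val + j.val + 1 = 3 then (1 : L) else 0).map (algebraMap L (UnitaryGroup.LocalRing L v)) := by
    rw [formCongr_one_eq, one_smul]
  have he : ∀ g, (cmDatumLocalCongr L v (1 : GL (Fin 3) (UnitaryGroup.LocalRing L v)) isUnit_one h1) g = g := fun g => by
    apply Subtype.ext
    rw [coe_cmDatumLocalCongr_apply, inv_one, mul_one, one_mul]
  have hes : ∀ g, (cmDatumLocalCongr L v (1 : GL (Fin 3) (UnitaryGroup.LocalRing L v)) isUnit_one h1).symm g = g := fun g => by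
    conv_lhs => rw [← he g]
    exact (cmDatumLocalCongr L v (1 : GL (Fin 3) (UnitaryGroup.LocalRing L v)) isUnit_one h1).symm_apply_apply g
  have hecoe : (fun x : ↥(unitaryGroupOfForm (conjLocal L (IsCMField.complexConj L) v) (cmLocalForm L 3 v)) => f ((cmDatumLocalCongr L v (1 : GL (Fin 3) (UnitaryGroup.LocalRing L v)) isUnit_one h1) x)) = f := funext fun x => by rw [he]
  have hmap : (Measure.map (⇑(cmDatumLocalCongr L v (1 : GL (Fin 3) (UnitaryGroup.LocalRing L v)) isUnit_one h1).symm) νQv : Measure ↥(unitaryGroupOfForm (conjLocal L (IsCMField.complexConj L) v) (cmLocalForm L 3 v))) = νQv := by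
    have : (⇑(cmDatumLocalCongr L v (1 : GL (Fin 3) (UnitaryGroup.LocalRing L v)) isUnit_one h1).symm : (UnitaryGroup.cmDatum L 3 (qsForm L)).Local v → ↥(unitaryGroupOfForm (conjLocal L (IsCMField.complexConj L) v) (cmLocalForm L 3 v))) = id := funext hes
    rw [this]
    exact Measure.map_id
  -- continuity of the pair character on the torus
  have hχc : Continuous fun t => ((UnitaryGroup.cmTorusCharPair L v χ.1 χ.2 t : ℂˣ) : ℂ) :=
    continuous_cmTorusCharPair_apply L v χ.1 χ.2 (Units.continuous_val.comp hχ1) (Units.continuous_val.comp hχ2)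
  -- the pseudo-coefficient's orbital integrals vanish at a.e. `t ∈ T` (regular ⇒ in `regG ∖ ellG`)
  have hae : ∀ᵐ (t : ↥(cmBorelTriple L 3 v).M) ∂μT, ∀ (d : Fin 3 → (UnitaryGroup.LocalRing L v)ˣ)
      (hd : glDiagonal 3 (UnitaryGroup.LocalRing L v) d =
        ((t : ↥(unitaryGroupOfForm (conjLocal L (IsCMField.complexConj L) v) (cmLocalForm L 3 v))) : GL (Fin 3) (UnitaryGroup.LocalRing L v)))
      (ha' : IsUnit ((((d 0)⁻¹ * d 1 : (UnitaryGroup.LocalRing L v)ˣ) : UnitaryGroup.LocalRing L v) - 1))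
      (hb' : IsUnit ((((d 0)⁻¹ * d 2 : (UnitaryGroup.LocalRing L v)ˣ) : UnitaryGroup.LocalRing L v) - 1)),
      (0 : ℂ) = ((UnitaryGroup.cmTorusCharPair L v χ.1 χ.2 t : ℂˣ) : ℂ) *
          ((rootDeltaChar (cmBorelTriple L 3 v).P
            ⟨(t : ↥(unitaryGroupOfForm (conjLocal L (IsCMField.complexConj L) v) (cmLocalForm L 3 v))), (cmBorelTriple L 3 v).M_le t.2⟩ : ℂˣ) : ℂ) *
        (((letI : MeasurableSpace (UnitaryGroup.LocalRing L v) := borel _; haveI : BorelSpace (UnitaryGroup.LocalRing L v) := ⟨rfl⟩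
          haveI : SecondCountableTopology (UnitaryGroup.LocalRing L v) := secondCountableTopology_localRing (E := L) v
          ((distribHaarChar (UnitaryGroup.LocalRing L v) ha'.unit)⁻¹ *
            (HeisRing.skewModulus (conjLocal L (IsCMField.complexConj L) v) (continuous_conjLocal L (IsCMField.complexConj L) v) hb'.unit
              (HeisRing.map_unit_torusCentralScalar_sub_one (conjLocal L (IsCMField.complexConj L) v) (cmLocalForm_eq_over L 3 v) t hd hb'))⁻¹ :
                NNReal)) : ℝ) : ℂ)⁻¹ *
        classOrbitalIntegral mQv f
          (ConjClasses.mk ((cmDatumLocalCongr L v (1 : GL (Fin 3) (UnitaryGroup.LocalRing L v)) isUnit_one h1) (t : ↥(unitaryGroupOfForm (conjLocal L (IsCMField.complexConj L) v) (cmLocalForm L 3 v))))) := by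
    filter_upwards [ae_isUnit_torusEntry_sub_three L v μT] with t ht
    intro d hd ha' hb'
    -- `t` is regular: its diagonal entries are pairwise distinct (units differences) in the field `L_w`
    have hdi : ∀ i, torusEntry (conjLocal L (IsCMField.complexConj L) v) (cmLocalForm L 3 v) i t = d i :=
      fun i => torusEntry_eq_of_glDiagonal_eq (conjLocal L (IsCMField.complexConj L) v) (cmLocalForm L 3 v) i t d hd
    have hinj : Function.Injective fun i : Fin 3 => ((d i : (UnitaryGroup.LocalRing L v)ˣ) : UnitaryGroup.LocalRing L v) := by
      intro i j hij
      by_contra hne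
      have hu := ht.1 i j hne
      rw [hdi i, hdi j] at hu
      have h0 : ((d i : (UnitaryGroup.LocalRing L v)ˣ) : UnitaryGroup.LocalRing L v) - d j = 0 := sub_eq_zero.2 hij
      rw [h0] at hu
      exact not_isUnit_zero hu
    have hregt : IsRegularElt ((((t : ↥(unitaryGroupOfForm (conjLocal L (IsCMField.complexConj L) v) (cmLocalForm L 3 v))) : Gqs L v).val :
        GL (Fin 3) (UnitaryGroup.LocalRing L v))) := by
      refine isRegularElt_of_eigenframe L (qsForm L) w hw ((t : ↥(unitaryGroupOfForm (conjLocal L (IsCMField.complexConj L) v) (cmLocalForm L 3 v))) : Gqs L v)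
        (Q := 1) (u := fun i : Fin 3 => ((d i : (UnitaryGroup.LocalRing L v)ˣ) : UnitaryGroup.LocalRing L v)) ?_ hinj
      rw [Units.val_one, Matrix.mul_one, Matrix.one_mul]
      show ((((t : ↥(unitaryGroupOfForm (conjLocal L (IsCMField.complexConj L) v) (cmLocalForm L 3 v))) : GL (Fin 3) (UnitaryGroup.LocalRing L v))) :
        Matrix (Fin 3) (Fin 3) (UnitaryGroup.LocalRing L v)) = Matrix.diagonal fun i => ((d i : (UnitaryGroup.LocalRing L v)ˣ) : UnitaryGroup.LocalRing L v)
      rw [← hd, coe_glDiagonal]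
    -- hence `e t = t ∈ regG ∖ ellG`, where the pseudo-coefficient's orbital integral vanishes
    have hγ : ((t : ↥(unitaryGroupOfForm (conjLocal L (IsCMField.complexConj L) v) (cmLocalForm L 3 v))) : Gqs L v) ∈ 𝔇.regG \ 𝔇.ellG :=
      ⟨(hreg _).2 hregt, hsplit t hregt⟩
    have h0 : classOrbitalIntegral mQv f (ConjClasses.mk ((cmDatumLocalCongr L v (1 : GL (Fin 3) (UnitaryGroup.LocalRing L v)) isUnit_one h1) (t : ↥(unitaryGroupOfForm (conjLocal L (IsCMField.complexConj L) v) (cmLocalForm L 3 v))))) = 0 := by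
      rw [he, ← horb]
      exact hf.2.1 _ hγ
    rw [h0, mul_zero]
  -- van Dijk against canonical orbital integrals with `Φ := 0`
  have key := smoothTrace_cmPrincipalSeries_map_symm_eq_inv_mul_integral L (qsForm L) (antidiagOne_isHermitian L 3) (isUnit_antidiagOne_det L 3) w hw
    (1 : GL (Fin 3) (UnitaryGroup.LocalRing L v)) isUnit_one h1 νQv hcanQ (UnitaryGroup.cmTorusCharPair L v χ.1 χ.2) hχc μT f hf.1.1 hf.1.2
    (fun _ => (0 : ℂ)) hae
  rw [integral_zero, mul_zero, hmap, hecoe] at key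
  exact key

set_option maxHeartbeats 1600000 in
set_option synthInstance.maxHeartbeats 400000 in
/-- **«PSE★» — `Tr i_G(χ)(f) = 0` for a `𝔇`-pseudo-coefficient `f` and every continuous pair `χ`, on `U(Φ₃)(L⁺_v)` (`v` non-split)**, from COMPAT
(`𝔇.orb = mQv`, `regG ↔ IsRegularElt`) and (SPLIT-NOT-ELL); the conclusion is the (PSE) socket of ★ `F0P3cStCharTSSaHead.stSupportFiniteSqInt_of_carpet` VERBATIM.
See the module docstring for the proof. [cite: Rogawski1990, §12.6 p. 187; §4.9 (4.9.4) p. 56; §12.7 Lemma 12.7.2 (proof) p. 192] -/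
theorem psTrace_pseudoCoeff_eq_zero
    (L : Type) [Field L] [NumberField L] [IsCMField L] (v : HeightOneSpectrum (𝓞 ↥(maximalRealSubfield L)))
    (hns : ∀ w : PlacesOver L v, IsCMField.complexConj L • w.1 = w.1)
    [MeasurableSpace ((UnitaryGroup.cmDatum L 2 (Matrix.of fun i j : Fin 2 => if i.val + j.val + 1 = 2 then (1 : L) else 0)).Local v × (UnitaryGroup.cmDatum L 1 (Matrix.of fun i j : Fin 1 => if i.val + j.val + 1 = 1 then (1 : L) else 0)).Local v)]
    [MeasurableSpace (Gqs L v)] [BorelSpace (Gqs L v)]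
    [∀ γ : Gqs L v, MeasurableSpace (Gqs L v ⧸ Subgroup.centralizer ({γ} : Set (Gqs L v)))]
    [∀ γ : Gqs L v, BorelSpace (Gqs L v ⧸ Subgroup.centralizer ({γ} : Set (Gqs L v)))]
    [MeasurableSpace (Gqs L v ⧸ Subgroup.center (Gqs L v))]
    (νQv : Measure (Gqs L v)) [νQv.IsHaarMeasure] [νQv.IsMulRightInvariant]
    (mQv : OrbitalMeasureFamily (Gqs L v))
    (hcanQ : mQv.IsCanonical (fun γ => IsRegularElt (γ.val : GL (Fin 3) (UnitaryGroup.LocalRing L v))) νQv)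
    (𝔇 : Ch12Sec5.EllipticData (Gqs L v) ((UnitaryGroup.cmDatum L 2 (Matrix.of fun i j : Fin 2 => if i.val + j.val + 1 = 2 then (1 : L) else 0)).Local v × (UnitaryGroup.cmDatum L 1 (Matrix.of fun i j : Fin 1 => if i.val + j.val + 1 = 1 then (1 : L) else 0)).Local v))
    -- ══ COMPAT (two of the seven clauses of the (S-𝔇) package): the datum's orbital-integral family and regular set ARE the organ's ══
    (horb : 𝔇.orb = mQv)
    (hreg : ∀ γ : Gqs L v, γ ∈ 𝔇.regG ↔ IsRegularElt (γ.val : GL (Fin 3) (UnitaryGroup.LocalRing L v)))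
    -- ══ (SPLIT-NOT-ELL) «regular elements of the split torus are not elliptic» [§12.5 p. 184] ══
    (hsplit : ∀ t : ↥(cmBorelTriple L 3 v).M,
      IsRegularElt ((((t : ↥(unitaryGroupOfForm (conjLocal L (IsCMField.complexConj L) v) (cmLocalForm L 3 v))) : Gqs L v).val :
        GL (Fin 3) (UnitaryGroup.LocalRing L v))) →
      ((t : ↥(unitaryGroupOfForm (conjLocal L (IsCMField.complexConj L) v) (cmLocalForm L 3 v))) : Gqs L v) ∉ 𝔇.ellG) :
    ∀ (π : IrrClass (Gqs L v)) (f : Gqs L v → ℂ), 𝔇.IsL2 π → 𝔇.IsPseudoCoeff π f →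
      ∀ χ : (((UnitaryGroup.LocalRing L v)ˣ →* ℂˣ) × (↥(normOneUnits (conjLocal L (IsCMField.complexConj L) v)) →* ℂˣ)), Continuous χ.1 → Continuous χ.2 →
        Representation.smoothTrace (G := Gqs L v) (UnitaryGroup.cmPrincipalSeries L 3 v (UnitaryGroup.cmTorusCharPair L v χ.1 χ.2)) νQv f = 0 :=
  fun π f _ hf χ hχ1 hχ2 => psTrace_pseudoCoeff_eq_zero_of_isPseudoCoeff L v hns νQv mQv hcanQ 𝔇 horb hreg hsplit π f hf χ hχ1 hχ2

end Summit.HodgeConjecture.HodgeConjecture.Cruxes.H413.F0P3cStCharTSPsePseudo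

end
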